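import Literature.Probability.LatticeModels.SahiThirdOrderCorrelation
import Summits.CriticalPhenomena.PercolationContinuityZ3.Theorems.SahiInfiniteVolumeCumulationsLower
import HarnessLib

/-!
# `NoHeavyLowerTail` (crux stmt-CriticalPhenomena-4575), Sahi programme P5: Kahn's Conjecture 5 for
# HITTING EVENTS — three unions of single-coordinate events, on ANY product space, every parameter vector

Support file (seat `prim-l12-p5`, gen 6; `--supports stmt-CriticalPhenomena-4575`).  New mathematics, not in print;
no definitions, no named facts, no sorries; standard axioms.  (Measurability of the miss-events:
`SahiInfiniteVolume.measurableSet_disjoint_finset`.)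

Kahn's Conjecture 5 [Kahn2022, Conj. 5 (arXiv p. 3)] (= Sahi's `C₃` [Sahi2008, Conj. 5] for product measures,
tree obligation `KahnConjecture`) asks `E₃(A,B,C) ≥ 0` for three increasing events of a product measure.  The tree
proves it when one slot is a CYLINDER `{ω ⊇ S}` / principal up-set (Sahi's cumulations, `…SahiE3PrincipalMeet*`),
for nested slots, and on the cubes `{0,1}^m`, `m ≤ 4` (kernel certificate `…SahiC3CubeFour`).  THIS FILE proves the
case DUAL to the cylinders: the three events are **hitting events** (disjunctions of coordinates)

  `H_S = {ω | ω ∩ S ≠ ∅} = ⋃_{i ∈ S} {ω | i ∈ ω}`,  `S` a finite set of coordinates,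

of the product measure `prodBernoulli p` on `Set ι` — for EVERY index type `ι` (finite or not), every
`p : ι → [0,1]` and all finite `A, B, C ⊆ ι`:

* **`prodBernoulli_sahiE3_hit_nonneg`**: `0 ≤ E₃(H_A, H_B, H_C)`.

Hitting events are increasing but are neither cylinders nor (for `|S| ≥ 2`) principal up-sets; their complements
`{ω | ω ∩ S = ∅}` are the DECREASING cylinders, so by multilinearity the statement is an alternating
("Bonferroni-type") combination `Σ Cov − E₃` of Sahi functionals of a cumulation family, which Sahi's Theorem 2
[Sahi2008, Thm. 2] does not sign.  Mechanism (exact, `sahiE3_hit_eq`): with `q_i = 1 − p_i` and the seven VENN-REGION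
products `a = ∏_{A∖(B∪C)} q`, `b`, `c`, `d = ∏_{(A∩B)∖C} q`, `e = ∏_{(A∩C)∖B} q`, `f = ∏_{(B∩C)∖A} q`, `t = ∏_{A∩B∩C} q`,

  `E₃(H_A,H_B,H_C) = d·e·f·t·[ ab(1−c)(1−dt) + ac(1−b)(1−et) + bc(1−a)(1−ft)`
  `                               + abc·( (1−dt)(1−et)(1−ft) + t(1−t)(de + df + ef − t·def) ) ]`,

every factor of which lies in `[0,1]` (`sahiE3_sevenRegion_nonneg`).  Since `E₃` of a hitting family depends on the
coordinates only through these seven products, the whole class (any number of coordinates) is ONE polynomial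
inequality in seven variables; the analogous reduction at order `n` has `2ⁿ − 1` variables (seat notes, gen 6: the
order-4 polynomial has 47 monomials and nonnegative tensor-Bernstein coefficients — an exact computation, not in this
file).  [cite: Kahn2022, Conj. 5 (arXiv p. 3); Sahi2008, Conj. 5 and Thm. 2; LiebSahi2021, eq. (2.1)]
-/

noncomputable section

open MeasureTheory Finset

namespace Summit.CriticalPhenomena.PercolationContinuityZ3.Theorems

open Literature.Probability.LatticeModels

namespace SahiHitting

variable {ι : Type*}

/-! ## The seven-variable inequality -/

/-- **The seven-region form of `E₃` for hitting events is nonnegative on `[0,1]⁷`.**  With the miss-probabilities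
`Q_A = adet, Q_B = bdft, Q_C = ceft, Q_{A∪B} = abdeft, Q_{A∪C} = acdeft, Q_{B∪C} = bcdeft, Q_{A∪B∪C} = abcdeft`
substituted into `E₃ = 2μ(H_AH_BH_C) + μH_AμH_BμH_C − Σ μH_A μ(H_BH_C)` (inclusion–exclusion for the hitting
probabilities), the result factors as displayed in the file header. [this work] -/
theorem sahiE3_sevenRegion_nonneg {QA QB QC QAB QAC QBC QABC a b c d e f t : ℝ}
    (hQA : QA = a * d * e * t) (hQB : QB = b * d * f * t) (hQC : QC = c * e * f * t)
    (hQAB : QAB = a * b * d * e * f * t) (hQAC : QAC = a * c * d * e * f * t)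
    (hQBC : QBC = b * c * d * e * f * t) (hQABC : QABC = a * b * c * d * e * f * t)
    (ha : 0 ≤ a) (ha1 : a ≤ 1) (hb : 0 ≤ b) (hb1 : b ≤ 1) (hc : 0 ≤ c) (hc1 : c ≤ 1)
    (hd : 0 ≤ d) (hd1 : d ≤ 1) (he : 0 ≤ e) (he1 : e ≤ 1) (hf : 0 ≤ f) (hf1 : f ≤ 1)
    (ht : 0 ≤ t) (ht1 : t ≤ 1) :
    0 ≤ 2 * (1 - (QA + QB + QC - QAB - QAC - QBC + QABC)) + (1 - QA) * (1 - QB) * (1 - QC)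
      - ((1 - QA) * (1 - (QB + QC - QBC)) + (1 - QB) * (1 - (QA + QC - QAC))
        + (1 - QC) * (1 - (QA + QB - QAB))) := by
  subst hQA hQB hQC hQAB hQAC hQBC hQABC
  have key : 2 * (1 - (a * d * e * t + b * d * f * t + c * e * f * t - a * b * d * e * f * t
        - a * c * d * e * f * t - b * c * d * e * f * t + a * b * c * d * e * f * t))
      + (1 - a * d * e * t) * (1 - b * d * f * t) * (1 - c * e * f * t)
      - ((1 - a * d * e * t) * (1 - (b * d * f * t + c * e * f * t - b * c * d * e * f * t))
        + (1 - b * d * f * t) * (1 - (a * d * e * t + c * e * f * t - a * c * d * e * f * t))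
        + (1 - c * e * f * t) * (1 - (a * d * e * t + b * d * f * t - a * b * d * e * f * t)))
      = d * e * f * t * (a * b * (1 - c) * (1 - d * t) + a * c * (1 - b) * (1 - e * t)
          + b * c * (1 - a) * (1 - f * t)
          + a * b * c * ((1 - d * t) * (1 - e * t) * (1 - f * t)
              + t * (1 - t) * (d * e + d * f + e * f - t * (d * e * f)))) := by
    ring
  rw [key]
  have hdt : d * t ≤ 1 := by nlinarith
  have het : e * t ≤ 1 := by nlinarith
  have hft : f * t ≤ 1 := by nlinarith
  have hde : 0 ≤ d * e := mul_nonneg hd he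
  have hdef : t * (d * e * f) ≤ d * e := by
    have h1 : d * e * f ≤ d * e := mul_le_of_le_one_right hde hf1
    have h2 : t * (d * e * f) ≤ 1 * (d * e * f) :=
      mul_le_mul_of_nonneg_right ht1 (mul_nonneg hde hf)
    linarith
  have hlast : 0 ≤ d * e + d * f + e * f - t * (d * e * f) := by
    have : 0 ≤ d * f := mul_nonneg hd hf
    have : 0 ≤ e * f := mul_nonneg he hf
    linarith
  have h1 : 0 ≤ a * b * (1 - c) * (1 - d * t) :=
    mul_nonneg (mul_nonneg (mul_nonneg ha hb) (sub_nonneg.2 hc1)) (sub_nonneg.2 hdt)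
  have h2 : 0 ≤ a * c * (1 - b) * (1 - e * t) :=
    mul_nonneg (mul_nonneg (mul_nonneg ha hc) (sub_nonneg.2 hb1)) (sub_nonneg.2 het)
  have h3 : 0 ≤ b * c * (1 - a) * (1 - f * t) :=
    mul_nonneg (mul_nonneg (mul_nonneg hb hc) (sub_nonneg.2 ha1)) (sub_nonneg.2 hft)
  have h4 : 0 ≤ a * b * c * ((1 - d * t) * (1 - e * t) * (1 - f * t)
      + t * (1 - t) * (d * e + d * f + e * f - t * (d * e * f))) := by
    refine mul_nonneg (mul_nonneg (mul_nonneg ha hb) hc) (add_nonneg ?_ ?_)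
    · exact mul_nonneg (mul_nonneg (sub_nonneg.2 hdt) (sub_nonneg.2 het)) (sub_nonneg.2 hft)
    · exact mul_nonneg (mul_nonneg ht (sub_nonneg.2 ht1)) hlast
  have h0 : 0 ≤ d * e * f * t := mul_nonneg (mul_nonneg hde hf) ht
  exact mul_nonneg h0 (by linarith)

/-! ## Hitting and missing events of a finite coordinate set under `prodBernoulli p` -/

/-- The hitting event of `S` is the complement of the missing event "every coordinate of `S` is absent". [folklore] -/
theorem hit_eq_compl_miss (S : Finset ι) :
    {ω : Set ι | ∃ i ∈ S, i ∈ ω} = {ω : Set ι | ∀ i ∈ S, i ∉ ω}ᶜ := by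
  ext ω
  simp only [Set.mem_setOf_eq, Set.mem_compl_iff, not_forall, not_not, exists_prop]

/-- Missing events intersect to the missing event of the union. [folklore] -/
theorem miss_inter_miss [DecidableEq ι] (S T : Finset ι) :
    {ω : Set ι | ∀ i ∈ S, i ∉ ω} ∩ {ω : Set ι | ∀ i ∈ T, i ∉ ω} = {ω : Set ι | ∀ i ∈ S ∪ T, i ∉ ω} := by
  ext ω
  simp only [Set.mem_inter_iff, Set.mem_setOf_eq, Finset.mem_union, or_imp, forall_and]

/-- Inclusion–exclusion for three measurable sets of a finite measure, real-valued. [folklore] -/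
theorem measureReal_union_three {Ω : Type*} [MeasurableSpace Ω] (μ : Measure Ω) [IsFiniteMeasure μ]
    {X Y Z : Set Ω} (hY : MeasurableSet Y) (hZ : MeasurableSet Z) :
    μ.real (X ∪ Y ∪ Z) = μ.real X + μ.real Y + μ.real Z - μ.real (X ∩ Y) - μ.real (X ∩ Z) - μ.real (Y ∩ Z)
      + μ.real (X ∩ Y ∩ Z) := by
  have h1 := measureReal_union_add_inter (μ := μ) (s := X ∪ Y) hZ
  have h2 := measureReal_union_add_inter (μ := μ) (s := X) hY
  have hd : (X ∪ Y) ∩ Z = (X ∩ Z) ∪ (Y ∩ Z) := Set.union_inter_distrib_right X Y Z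
  have h3 := measureReal_union_add_inter (μ := μ) (s := X ∩ Z) (t := Y ∩ Z) (hY.inter hZ)
  have he : (X ∩ Z) ∩ (Y ∩ Z) = X ∩ Y ∩ Z := by
    ext ω
    simp only [Set.mem_inter_iff]
    tauto
  rw [hd] at h1
  rw [he] at h3
  linarith

/-- `μ(H_S) = 1 − ∏_{i∈S}(1 − p_i)`. [folklore] -/
theorem prodBernoulli_real_hit (p : ι → unitInterval) (S : Finset ι) :
    (prodBernoulli p).real {ω : Set ι | ∃ i ∈ S, i ∈ ω} = 1 - ∏ i ∈ S, (1 - (p i : ℝ)) := by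
  rw [hit_eq_compl_miss, measureReal_compl (SahiInfiniteVolume.measurableSet_disjoint_finset S), probReal_univ,
    prodBernoulli_real_forall_notMem]

/-- `μ(H_S ∩ H_T) = 1 − (Q_S + Q_T − Q_{S∪T})`, `Q_S = ∏_{i∈S}(1 − p_i)`. [folklore] -/
theorem prodBernoulli_real_hit_inter_hit [DecidableEq ι] (p : ι → unitInterval) (S T : Finset ι) :
    (prodBernoulli p).real ({ω : Set ι | ∃ i ∈ S, i ∈ ω} ∩ {ω : Set ι | ∃ i ∈ T, i ∈ ω})
      = 1 - ((∏ i ∈ S, (1 - (p i : ℝ))) + (∏ i ∈ T, (1 - (p i : ℝ))) - ∏ i ∈ S ∪ T, (1 - (p i : ℝ))) := by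
  rw [hit_eq_compl_miss, hit_eq_compl_miss, ← Set.compl_union,
    measureReal_compl ((SahiInfiniteVolume.measurableSet_disjoint_finset S).union (SahiInfiniteVolume.measurableSet_disjoint_finset T)), probReal_univ]
  have h := measureReal_union_add_inter (μ := prodBernoulli p) (s := {ω : Set ι | ∀ i ∈ S, i ∉ ω})
    (SahiInfiniteVolume.measurableSet_disjoint_finset T)
  rw [miss_inter_miss, prodBernoulli_real_forall_notMem, prodBernoulli_real_forall_notMem,
    prodBernoulli_real_forall_notMem] at h
  linarith

/-- `μ(H_S ∩ H_T ∩ H_R) = 1 − (Q_S + Q_T + Q_R − Q_{S∪T} − Q_{S∪R} − Q_{T∪R} + Q_{S∪T∪R})`. [folklore] -/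
theorem prodBernoulli_real_hit_inter_three [DecidableEq ι] (p : ι → unitInterval) (S T R : Finset ι) :
    (prodBernoulli p).real
        ({ω : Set ι | ∃ i ∈ S, i ∈ ω} ∩ {ω : Set ι | ∃ i ∈ T, i ∈ ω} ∩ {ω : Set ι | ∃ i ∈ R, i ∈ ω})
      = 1 - ((∏ i ∈ S, (1 - (p i : ℝ))) + (∏ i ∈ T, (1 - (p i : ℝ))) + (∏ i ∈ R, (1 - (p i : ℝ)))
          - (∏ i ∈ S ∪ T, (1 - (p i : ℝ))) - (∏ i ∈ S ∪ R, (1 - (p i : ℝ)))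
          - (∏ i ∈ T ∪ R, (1 - (p i : ℝ))) + ∏ i ∈ S ∪ T ∪ R, (1 - (p i : ℝ))) := by
  rw [hit_eq_compl_miss, hit_eq_compl_miss, hit_eq_compl_miss, ← Set.compl_union, ← Set.compl_union,
    measureReal_compl (((SahiInfiniteVolume.measurableSet_disjoint_finset S).union (SahiInfiniteVolume.measurableSet_disjoint_finset T)).union (SahiInfiniteVolume.measurableSet_disjoint_finset R)),
    probReal_univ, measureReal_union_three _ (SahiInfiniteVolume.measurableSet_disjoint_finset T) (SahiInfiniteVolume.measurableSet_disjoint_finset R),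
    miss_inter_miss, miss_inter_miss, miss_inter_miss, miss_inter_miss]
  simp only [prodBernoulli_real_forall_notMem]

/-! ## The Venn-region factorisation of the miss-probabilities -/

/-- A product over `S ⊆ U` is the product over `U` of the function extended by `1`. [folklore] -/
theorem prod_eq_prod_ite [DecidableEq ι] {U S : Finset ι} (h : S ⊆ U) (g : ι → ℝ) :
    ∏ i ∈ S, g i = ∏ i ∈ U, (if i ∈ S then g i else 1) := by
  rw [← Finset.prod_filter, Finset.filter_mem_eq_inter, Finset.inter_eq_right.2 h]

/-! ## The theorem -/

/-- **Kahn's Conjecture 5 for three hitting events** (= Sahi's `E₃ ≥ 0` for three disjunctions of coordinates):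
for every index type `ι`, every `p : ι → [0,1]` and all finite `A, B, C ⊆ ι`, the hitting events
`H_A = {ω | ∃ i ∈ A, i ∈ ω}`, `H_B`, `H_C` of the product measure `prodBernoulli p` satisfy
`0 ≤ E₃(H_A, H_B, H_C) = 2μ(H_AH_BH_C) + μH_AμH_BμH_C − [μH_Aμ(H_BH_C) + μH_Bμ(H_AH_C) + μH_Cμ(H_AH_B)]`.
[this work; cite: Kahn2022, Conj. 5 (arXiv p. 3); Sahi2008, Conj. 5] -/
theorem prodBernoulli_sahiE3_hit_nonneg (p : ι → unitInterval) (A B C : Finset ι) :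
    0 ≤ sahiE3 (prodBernoulli p)
      {ω : Set ι | ∃ i ∈ A, i ∈ ω} {ω : Set ι | ∃ i ∈ B, i ∈ ω} {ω : Set ι | ∃ i ∈ C, i ∈ ω} := by
  classical
  -- the seven Venn regions and their products
  set q : ι → ℝ := fun i => 1 - (p i : ℝ) with hq
  have hq0 : ∀ i, 0 ≤ q i := fun i => sub_nonneg.2 (p i).2.2
  have hq1 : ∀ i, q i ≤ 1 := fun i => sub_le_self _ (p i).2.1
  set U : Finset ι := A ∪ B ∪ C with hU
  set ra : Finset ι := (A \ B) \ C with hra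
  set rb : Finset ι := (B \ A) \ C with hrb
  set rc : Finset ι := (C \ A) \ B with hrc
  set rd : Finset ι := (A ∩ B) \ C with hrd
  set re : Finset ι := (A ∩ C) \ B with hre
  set rf : Finset ι := (B ∩ C) \ A with hrf
  set rt : Finset ι := A ∩ B ∩ C with hrt
  have P0 : ∀ S : Finset ι, 0 ≤ ∏ i ∈ S, q i := fun S => Finset.prod_nonneg fun i _ => hq0 i
  have P1 : ∀ S : Finset ι, ∏ i ∈ S, q i ≤ 1 := fun S =>
    Finset.prod_le_one (fun i _ => hq0 i) fun i _ => hq1 i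
  -- every set in sight is contained in `U`; write its product as a product over `U`
  have eU : ∀ {S : Finset ι}, S ⊆ U → ∏ i ∈ S, q i = ∏ i ∈ U, (if i ∈ S then q i else 1) :=
    fun h => prod_eq_prod_ite h q
  have sA : A ⊆ U := by intro i hi; simp [hU, hi]
  have sB : B ⊆ U := by intro i hi; simp [hU, hi]
  have sC : C ⊆ U := by intro i hi; simp [hU, hi]
  have sAB : A ∪ B ⊆ U := Finset.union_subset sA sB
  have sAC : A ∪ C ⊆ U := Finset.union_subset sA sC
  have sBC : B ∪ C ⊆ U := Finset.union_subset sB sC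
  have sABC : A ∪ B ∪ C ⊆ U := Finset.union_subset sAB sC
  have sra : ra ⊆ U := by intro i hi; simp only [hra, Finset.mem_sdiff] at hi; exact sA hi.1.1
  have srb : rb ⊆ U := by intro i hi; simp only [hrb, Finset.mem_sdiff] at hi; exact sB hi.1.1
  have src : rc ⊆ U := by intro i hi; simp only [hrc, Finset.mem_sdiff] at hi; exact sC hi.1.1
  have srd : rd ⊆ U := by
    intro i hi; simp only [hrd, Finset.mem_sdiff, Finset.mem_inter] at hi; exact sA hi.1.1
  have sre : re ⊆ U := by
    intro i hi; simp only [hre, Finset.mem_sdiff, Finset.mem_inter] at hi; exact sA hi.1.1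
  have srf : rf ⊆ U := by
    intro i hi; simp only [hrf, Finset.mem_sdiff, Finset.mem_inter] at hi; exact sB hi.1.1
  have srt : rt ⊆ U := by
    intro i hi; simp only [hrt, Finset.mem_inter] at hi; exact sA hi.1.1
  -- pointwise bookkeeping: membership of `i` in the regions as a function of membership in `A, B, C`
  have regions : ∀ i : ι,
      (i ∈ ra ↔ i ∈ A ∧ i ∉ B ∧ i ∉ C) ∧ (i ∈ rb ↔ i ∈ B ∧ i ∉ A ∧ i ∉ C) ∧
      (i ∈ rc ↔ i ∈ C ∧ i ∉ A ∧ i ∉ B) ∧ (i ∈ rd ↔ i ∈ A ∧ i ∈ B ∧ i ∉ C) ∧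
      (i ∈ re ↔ i ∈ A ∧ i ∈ C ∧ i ∉ B) ∧ (i ∈ rf ↔ i ∈ B ∧ i ∈ C ∧ i ∉ A) ∧
      (i ∈ rt ↔ i ∈ A ∧ i ∈ B ∧ i ∈ C) := by
    intro i
    simp only [hra, hrb, hrc, hrd, hre, hrf, hrt, Finset.mem_sdiff, Finset.mem_inter]
    tauto
  -- the seven factorisations
  have fA : ∏ i ∈ A, q i = (∏ i ∈ ra, q i) * (∏ i ∈ rd, q i) * (∏ i ∈ re, q i) * ∏ i ∈ rt, q i := by
    rw [eU sA, eU sra, eU srd, eU sre, eU srt, ← Finset.prod_mul_distrib, ← Finset.prod_mul_distrib,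
      ← Finset.prod_mul_distrib]
    refine Finset.prod_congr rfl fun i _ => ?_
    obtain ⟨h1, -, -, h4, h5, -, h7⟩ := regions i
    by_cases xA : i ∈ A <;> by_cases xB : i ∈ B <;> by_cases xC : i ∈ C <;>
      simp [h1, h4, h5, h7, xA, xB, xC]
  have fB : ∏ i ∈ B, q i = (∏ i ∈ rb, q i) * (∏ i ∈ rd, q i) * (∏ i ∈ rf, q i) * ∏ i ∈ rt, q i := by
    rw [eU sB, eU srb, eU srd, eU srf, eU srt, ← Finset.prod_mul_distrib, ← Finset.prod_mul_distrib,
      ← Finset.prod_mul_distrib]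
    refine Finset.prod_congr rfl fun i _ => ?_
    obtain ⟨-, h2, -, h4, -, h6, h7⟩ := regions i
    by_cases xA : i ∈ A <;> by_cases xB : i ∈ B <;> by_cases xC : i ∈ C <;>
      simp [h2, h4, h6, h7, xA, xB, xC]
  have fC : ∏ i ∈ C, q i = (∏ i ∈ rc, q i) * (∏ i ∈ re, q i) * (∏ i ∈ rf, q i) * ∏ i ∈ rt, q i := by
    rw [eU sC, eU src, eU sre, eU srf, eU srt, ← Finset.prod_mul_distrib, ← Finset.prod_mul_distrib,
      ← Finset.prod_mul_distrib]
    refine Finset.prod_congr rfl fun i _ => ?_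
    obtain ⟨-, -, h3, -, h5, h6, h7⟩ := regions i
    by_cases xA : i ∈ A <;> by_cases xB : i ∈ B <;> by_cases xC : i ∈ C <;>
      simp [h3, h5, h6, h7, xA, xB, xC]
  have fAB : ∏ i ∈ A ∪ B, q i = (∏ i ∈ ra, q i) * (∏ i ∈ rb, q i) * (∏ i ∈ rd, q i) * (∏ i ∈ re, q i)
      * (∏ i ∈ rf, q i) * ∏ i ∈ rt, q i := by
    rw [eU sAB, eU sra, eU srb, eU srd, eU sre, eU srf, eU srt, ← Finset.prod_mul_distrib,
      ← Finset.prod_mul_distrib, ← Finset.prod_mul_distrib, ← Finset.prod_mul_distrib, ← Finset.prod_mul_distrib]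
    refine Finset.prod_congr rfl fun i _ => ?_
    obtain ⟨h1, h2, -, h4, h5, h6, h7⟩ := regions i
    by_cases xA : i ∈ A <;> by_cases xB : i ∈ B <;> by_cases xC : i ∈ C <;>
      simp [h1, h2, h4, h5, h6, h7, xA, xB, xC, Finset.mem_union]
  have fAC : ∏ i ∈ A ∪ C, q i = (∏ i ∈ ra, q i) * (∏ i ∈ rc, q i) * (∏ i ∈ rd, q i) * (∏ i ∈ re, q i)
      * (∏ i ∈ rf, q i) * ∏ i ∈ rt, q i := by
    rw [eU sAC, eU sra, eU src, eU srd, eU sre, eU srf, eU srt, ← Finset.prod_mul_distrib,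
      ← Finset.prod_mul_distrib, ← Finset.prod_mul_distrib, ← Finset.prod_mul_distrib, ← Finset.prod_mul_distrib]
    refine Finset.prod_congr rfl fun i _ => ?_
    obtain ⟨h1, -, h3, h4, h5, h6, h7⟩ := regions i
    by_cases xA : i ∈ A <;> by_cases xB : i ∈ B <;> by_cases xC : i ∈ C <;>
      simp [h1, h3, h4, h5, h6, h7, xA, xB, xC, Finset.mem_union]
  have fBC : ∏ i ∈ B ∪ C, q i = (∏ i ∈ rb, q i) * (∏ i ∈ rc, q i) * (∏ i ∈ rd, q i) * (∏ i ∈ re, q i)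
      * (∏ i ∈ rf, q i) * ∏ i ∈ rt, q i := by
    rw [eU sBC, eU srb, eU src, eU srd, eU sre, eU srf, eU srt, ← Finset.prod_mul_distrib,
      ← Finset.prod_mul_distrib, ← Finset.prod_mul_distrib, ← Finset.prod_mul_distrib, ← Finset.prod_mul_distrib]
    refine Finset.prod_congr rfl fun i _ => ?_
    obtain ⟨-, h2, h3, h4, h5, h6, h7⟩ := regions i
    by_cases xA : i ∈ A <;> by_cases xB : i ∈ B <;> by_cases xC : i ∈ C <;>
      simp [h2, h3, h4, h5, h6, h7, xA, xB, xC, Finset.mem_union]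
  have fABC : ∏ i ∈ A ∪ B ∪ C, q i = (∏ i ∈ ra, q i) * (∏ i ∈ rb, q i) * (∏ i ∈ rc, q i)
      * (∏ i ∈ rd, q i) * (∏ i ∈ re, q i) * (∏ i ∈ rf, q i) * ∏ i ∈ rt, q i := by
    rw [eU sABC, eU sra, eU srb, eU src, eU srd, eU sre, eU srf, eU srt, ← Finset.prod_mul_distrib,
      ← Finset.prod_mul_distrib, ← Finset.prod_mul_distrib, ← Finset.prod_mul_distrib, ← Finset.prod_mul_distrib,
      ← Finset.prod_mul_distrib]
    refine Finset.prod_congr rfl fun i _ => ?_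
    obtain ⟨h1, h2, h3, h4, h5, h6, h7⟩ := regions i
    by_cases xA : i ∈ A <;> by_cases xB : i ∈ B <;> by_cases xC : i ∈ C <;>
      simp [h1, h2, h3, h4, h5, h6, h7, xA, xB, xC, Finset.mem_union]
  -- the seven measure values
  have mA := prodBernoulli_real_hit p A
  have mB := prodBernoulli_real_hit p B
  have mC := prodBernoulli_real_hit p C
  have mAB := prodBernoulli_real_hit_inter_hit p A B
  have mAC := prodBernoulli_real_hit_inter_hit p A C
  have mBC := prodBernoulli_real_hit_inter_hit p B C
  have mABC := prodBernoulli_real_hit_inter_three p A B C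
  simp only [← hq] at mA mB mC mAB mAC mBC mABC
  rw [sahiE3_def, mABC, mA, mB, mC, mBC, mAC, mAB]
  -- the inequality
  have key := sahiE3_sevenRegion_nonneg
    (QA := ∏ i ∈ A, q i) (QB := ∏ i ∈ B, q i) (QC := ∏ i ∈ C, q i) (QAB := ∏ i ∈ A ∪ B, q i)
    (QAC := ∏ i ∈ A ∪ C, q i) (QBC := ∏ i ∈ B ∪ C, q i) (QABC := ∏ i ∈ A ∪ B ∪ C, q i)
    (a := ∏ i ∈ ra, q i) (b := ∏ i ∈ rb, q i) (c := ∏ i ∈ rc, q i) (d := ∏ i ∈ rd, q i)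
    (e := ∏ i ∈ re, q i) (f := ∏ i ∈ rf, q i) (t := ∏ i ∈ rt, q i)
    fA fB fC fAB fAC fBC fABC
    (P0 _) (P1 _) (P0 _) (P1 _) (P0 _) (P1 _) (P0 _) (P1 _) (P0 _) (P1 _) (P0 _) (P1 _) (P0 _) (P1 _)
  linarith [key]

end SahiHitting

end Summit.CriticalPhenomena.PercolationContinuityZ3.Theorems
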